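import Mathlib.RingTheory.PowerSeries.Derivative
import Mathlib.RingTheory.Derivation.Basic
import Mathlib.Algebra.CharP.Lemmas
import Mathlib.Data.Nat.Factorial.BigOperators
import Mathlib.Data.Nat.Choose.Dvd
import Literature.RingTheory.TwoVariableSeries.Basic
import HarnessLib

/-!
# Derivations of `R⟦t⟧⟦s⟧`: `∂/∂t` on the coefficients, `∂/∂s`, base change, orders, and
# `(d/dt)^p = 0` in characteristic `p` (proofs only)

Topic `Literature/RingTheory/FormalGroups`. Bookkeeping for two-variable formal power series in
the nested form `R⟦t⟧⟦s⟧ = PowerSeries (PowerSeries R)` (inner variable `t`, outer variable `s`),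
as used for the formal leaves of the invariant foliation on a product of two formal groups of
elliptic curves (Bost, Publ. Math. IHÉS 93 (2001), §2.1.2, §3.4.1–3.4.2: the normalised vector
field `∂/∂x₁ + a ∂/∂x₂`, its formal flow, and the `p`-adic estimate Prop. 3.9 via the `p`-th power
of its reduction):

* `exists_dt` — the derivation `∂/∂t` acting on each `s`-coefficient (a `Derivation ℤ` with
  `coeff n (Dt f) = d⁄dX R (coeff n f)`; below `Dt` is any such derivation), its values on
  `s`-constants `C g` and on `s`-series with constant coefficients `h.map C`, and its commutation
  with `∂/∂s = d⁄dX R⟦t⟧`;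
* base change along `ψ : R →+* R'` (`map (map ψ)`) commutes with both derivations;
* `s`-adic order: `X^m ∣ f → X^m ∣ Dt f`, `X^(m+1) ∣ f → X^m ∣ ∂f/∂s`;
* **Taylor's formula for formal power series**: `[tⁿ] g · n! = (g⁽ⁿ⁾)(0)`
  (`constantCoeff_iterate_derivative`);
* **`(d/dt)^p = 0` on `R⟦t⟧` in characteristic `p`** (`iterate_derivative_prime_eq_zero`: the
  coefficient `(n+1)(n+2)⋯(n+p)` is divisible by `p`);
* **`(u + v)^p = u^p + v^p` for commuting additive maps of an abelian group killed by `p`**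
  (`iterate_add_prime_of_commute`; Jacobson, *Lie algebras*, V.7).

## Sources

* J.-B. Bost, *Algebraic leaves of algebraic foliations over number fields*, Publ. Math. IHÉS
  93 (2001), §3.4.1 (formal flows, (3.5)–(3.8)), §3.4.2, Prop. 3.9. [Bost2001AlgebraicLeaves]
* N. Jacobson, *Lie Algebras* (1962), V.7, pp. 186–187. [Jacobson1962LieAlgebras]

## Design notes

Theorems only; no definitions, no named facts. `CharP` for power series rings is the tree's
`Literature.RingTheory.TwoVariableSeries.charP_powerSeries`.
-/

noncomputable section

open PowerSeries Finset
open scoped Nat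

namespace Literature.RingTheory.FormalGroups

namespace NestedSeries

variable {R : Type*} [CommRing R]

/-! ### `∂/∂t`: the derivative on the `s`-coefficients -/

/-- **The derivation `∂/∂t` of `R⟦t⟧⟦s⟧`** (the derivative `d/dt` of each `s`-coefficient)
exists as a `ℤ`-derivation. [folklore] -/
theorem exists_dt :
    ∃ Dt : Derivation ℤ (PowerSeries (PowerSeries R)) (PowerSeries (PowerSeries R)),
      ∀ f n, coeff n (Dt f) = d⁄dX R (coeff n f) := by
  let F : PowerSeries (PowerSeries R) →+ PowerSeries (PowerSeries R) :=
    { toFun := fun f => PowerSeries.mk fun n => d⁄dX R (coeff n f)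
      map_zero' := by ext n; simp only [coeff_mk, map_zero]
      map_add' := fun f g => by ext n; simp only [coeff_mk, map_add] }
  have hF : ∀ f n, coeff n (F f) = d⁄dX R (coeff n f) := fun f n => by
    simp only [F, AddMonoidHom.coe_mk, ZeroHom.coe_mk, coeff_mk]
  refine ⟨Derivation.mk' F.toIntLinearMap fun f g => ?_, fun f n => hF f n⟩
  change F (f * g) = f • F g + g • F f
  refine PowerSeries.ext fun n => ?_
  rw [smul_eq_mul, smul_eq_mul, hF, coeff_mul, map_sum, map_add, coeff_mul, coeff_mul]
  simp_rw [Derivation.leibniz, smul_eq_mul, hF]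
  rw [sum_add_distrib]
  congr 1
  rw [← Nat.sum_antidiagonal_swap]
  rfl

variable (Dt : Derivation ℤ (PowerSeries (PowerSeries R)) (PowerSeries (PowerSeries R)))
  (hDt : ∀ f n, coeff n (Dt f) = d⁄dX R (coeff n f))

include hDt in
/-- `∂/∂t` of an `s`-constant `g(t)`: `Dt (C g) = C (dg/dt)`. [folklore] -/
theorem dt_C (g : PowerSeries R) : Dt (C g) = C (d⁄dX R g) := by
  refine PowerSeries.ext fun n => ?_
  rw [hDt, coeff_C, coeff_C]
  split_ifs
  · rfl
  · exact (d⁄dX R).map_zero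

include hDt in
/-- `∂/∂t` kills series in `s` with constant coefficients: `Dt (h(s)) = 0`. [folklore] -/
theorem dt_map_C (h : PowerSeries R) : Dt (h.map (C : R →+* PowerSeries R)) = 0 := by
  refine PowerSeries.ext fun n => ?_
  rw [hDt, coeff_map, derivative_C, map_zero]

include hDt in
/-- `∂/∂t` kills the variable `s`. [folklore] -/
theorem dt_X : Dt (X : PowerSeries (PowerSeries R)) = 0 := by
  have : (X : PowerSeries (PowerSeries R)) = (X : PowerSeries R).map (C : R →+* PowerSeries R) := by
    rw [map_X]
  rw [this, dt_map_C Dt hDt]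

include hDt in
/-- `∂/∂t` kills powers of `s`. [folklore] -/
theorem dt_X_pow (m : ℕ) : Dt ((X : PowerSeries (PowerSeries R)) ^ m) = 0 := by
  rw [Derivation.leibniz_pow, dt_X Dt hDt, smul_zero, smul_zero]

/-- `∂/∂s` of a series in `s` with constant coefficients is the coefficientwise derivative.
[folklore] -/
theorem derivative_map_C (h : PowerSeries R) :
    d⁄dX (PowerSeries R) (h.map (C : R →+* PowerSeries R)) =
      (d⁄dX R h).map (C : R →+* PowerSeries R) := by
  refine PowerSeries.ext fun n => ?_
  rw [coeff_derivative, coeff_map, coeff_map, coeff_derivative, map_mul, map_add, map_natCast,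
    map_one]

include hDt in
/-- **`∂/∂t` and `∂/∂s` commute.** [folklore] -/
theorem dt_derivative_comm (f : PowerSeries (PowerSeries R)) :
    Dt (d⁄dX (PowerSeries R) f) = d⁄dX (PowerSeries R) (Dt f) := by
  refine PowerSeries.ext fun n => ?_
  rw [hDt, coeff_derivative, coeff_derivative, hDt, ← Nat.cast_succ, ← nsmul_eq_mul',
    ← nsmul_eq_mul', map_nsmul]

/-! ### Base change -/

section BaseChange

variable {R' : Type*} [CommRing R'] (ψ : R →+* R')
  (Dt' : Derivation ℤ (PowerSeries (PowerSeries R')) (PowerSeries (PowerSeries R')))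
  (hDt' : ∀ f n, coeff n (Dt' f) = d⁄dX R' (coeff n f))

/-- `d/dt` commutes with base change. [folklore] -/
theorem map_derivative (g : PowerSeries R) :
    (d⁄dX R g).map ψ = d⁄dX R' (g.map ψ) := by
  ext n
  rw [coeff_map, coeff_derivative, coeff_derivative, coeff_map, map_mul, map_add, map_natCast,
    map_one]

/-- Base change of an `s`-constant. [folklore] -/
theorem map_map_C (g : PowerSeries R) :
    (C g : PowerSeries (PowerSeries R)).map (PowerSeries.map ψ) = C (g.map ψ) := by
  rw [map_C]

/-- Base change of a series in `s` with constant coefficients. [folklore] -/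
theorem map_map_map_C (h : PowerSeries R) :
    (h.map (C : R →+* PowerSeries R)).map (PowerSeries.map ψ) =
      (h.map ψ).map (C : R' →+* PowerSeries R') := by
  rw [← RingHom.comp_apply (PowerSeries.map (PowerSeries.map ψ)), ← PowerSeries.map_comp,
    ← RingHom.comp_apply (PowerSeries.map (C : R' →+* PowerSeries R')), ← PowerSeries.map_comp]
  congr 2
  ext r
  simp only [RingHom.comp_apply, map_C]

include hDt hDt' in
/-- **`∂/∂t` commutes with base change.** [folklore] -/
theorem map_dt (f : PowerSeries (PowerSeries R)) :
    (Dt f).map (PowerSeries.map ψ) = Dt' (f.map (PowerSeries.map ψ)) := by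
  refine PowerSeries.ext fun n => ?_
  rw [coeff_map, hDt, hDt', coeff_map, map_derivative]

/-- **`∂/∂s` commutes with base change.** [folklore] -/
theorem map_derivative_outer (f : PowerSeries (PowerSeries R)) :
    (d⁄dX (PowerSeries R) f).map (PowerSeries.map ψ) =
      d⁄dX (PowerSeries R') (f.map (PowerSeries.map ψ)) :=
  map_derivative (PowerSeries.map ψ) f

end BaseChange

/-! ### `s`-adic orders -/

include hDt in
/-- `∂/∂t` preserves divisibility by `sᵐ`. [folklore] -/
theorem X_pow_dvd_dt {m : ℕ} {f : PowerSeries (PowerSeries R)} (h : X ^ m ∣ f) :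
    X ^ m ∣ Dt f := by
  rw [X_pow_dvd_iff] at h ⊢
  intro k hk
  rw [hDt, h k hk, map_zero]

/-- `∂/∂s` lowers divisibility by `s` by at most one: `s^{m+1} ∣ f → sᵐ ∣ ∂f/∂s`. [folklore] -/
theorem X_pow_dvd_derivative {m : ℕ} {f : PowerSeries (PowerSeries R)} (h : X ^ (m + 1) ∣ f) :
    X ^ m ∣ d⁄dX (PowerSeries R) f := by
  rw [X_pow_dvd_iff] at h ⊢
  intro k hk
  rw [coeff_derivative, h (k + 1) (by omega), zero_mul]

/-- If `sᵐ ∣ f` with `m ≥ 1` then `f(t, 0) = 0`, i.e. the constant coefficient vanishes.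
[folklore] -/
theorem constantCoeff_eq_zero_of_X_pow_dvd {m : ℕ} (hm : 1 ≤ m) {f : PowerSeries (PowerSeries R)}
    (h : X ^ m ∣ f) : constantCoeff f = 0 := by
  obtain ⟨g, rfl⟩ := h
  obtain ⟨k, rfl⟩ : ∃ k, m = k + 1 := ⟨m - 1, by omega⟩
  rw [map_mul, map_pow, constantCoeff_X, zero_pow (Nat.succ_ne_zero k), zero_mul]

/-! ### Taylor's formula and `(d/dt)^p = 0` -/

/-- The coefficients of the iterated derivative: `[tᵏ] g⁽ⁿ⁾ = (k+n)(k+n-1)⋯(k+1) · [t^{k+n}] g`.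
[folklore] -/
theorem coeff_iterate_derivative (g : PowerSeries R) (n k : ℕ) :
    coeff k ((⇑(d⁄dX R))^[n] g) = ((k + n).descFactorial n : R) * coeff (k + n) g := by
  induction n generalizing k with
  | zero => simp
  | succ n ih =>
    rw [Function.iterate_succ_apply', coeff_derivative, ih, Nat.descFactorial_succ,
      show k + 1 + n = k + (n + 1) by ring, show k + (n + 1) - n = k + 1 by omega]
    push_cast
    ring

/-- **Taylor's formula for formal power series**: `(g⁽ⁿ⁾)(0) = n! · [tⁿ] g`. [folklore] -/
theorem constantCoeff_iterate_derivative (g : PowerSeries R) (n : ℕ) :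
    constantCoeff ((⇑(d⁄dX R))^[n] g) = (n ! : R) * coeff n g := by
  rw [← coeff_zero_eq_constantCoeff_apply, coeff_iterate_derivative, zero_add,
    Nat.descFactorial_self]

/-- **`(d/dt)^p = 0` on `R⟦t⟧` in characteristic `p`**: the coefficient
`(k+1)(k+2)⋯(k+p)` of `[tᵏ] g⁽ᵖ⁾` is divisible by `p! `, hence by `p`. [cite: Jacobson1962LieAlgebras, V.7] -/
theorem iterate_derivative_prime_eq_zero (p : ℕ) [hp : Fact p.Prime] [CharP R p]
    (g : PowerSeries R) : (⇑(d⁄dX R))^[p] g = 0 := by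
  ext k
  rw [coeff_iterate_derivative, map_zero]
  have hdvd : p ∣ (k + p).descFactorial p :=
    (Nat.dvd_factorial hp.out.pos le_rfl).trans (Nat.factorial_dvd_descFactorial _ _)
  rw [(CharP.cast_eq_zero_iff R p _).mpr hdvd, zero_mul]

/-! ### `(u + v)^p = u^p + v^p` for commuting additive maps in characteristic `p` -/

/-- The binomial expansion for commuting additive maps:
`(u + v)ⁿ(x) = Σ_{k ≤ n} C(n,k) · uᵏ(vⁿ⁻ᵏ(x))`. [folklore] -/
theorem iterate_add_eq_sum_choose {M : Type*} [AddCommGroup M] (u v : M →+ M)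
    (huv : ∀ x, u (v x) = v (u x)) (n : ℕ) (x : M) :
    (fun y => u y + v y)^[n] x =
      ∑ k ∈ range (n + 1), n.choose k • (⇑u)^[k] ((⇑v)^[n - k] x) := by
  have hc : Function.Commute u v := huv
  induction n generalizing x with
  | zero => simp
  | succ n ih =>
    rw [Function.iterate_succ_apply', ih, map_sum, map_sum, ← sum_add_distrib]
    have hterm : ∀ k ∈ range (n + 1),
        u (n.choose k • (⇑u)^[k] ((⇑v)^[n - k] x)) + v (n.choose k • (⇑u)^[k] ((⇑v)^[n - k] x)) =
          n.choose k • (⇑u)^[k] ((⇑v)^[n + 1 - k] x) +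
            n.choose k • (⇑u)^[k + 1] ((⇑v)^[n - k] x) := by
      intro k hk
      have hk' : k ≤ n := Nat.lt_succ_iff.mp (mem_range.mp hk)
      have e1 : (⇑v)^[n + 1 - k] x = v ((⇑v)^[n - k] x) := by
        rw [show n + 1 - k = n - k + 1 by omega, Function.iterate_succ_apply']
      have e2 : (⇑u)^[k + 1] ((⇑v)^[n - k] x) = u ((⇑u)^[k] ((⇑v)^[n - k] x)) :=
        Function.iterate_succ_apply' _ _ _
      rw [map_nsmul, map_nsmul, add_comm, ← (hc.iterate_left k).eq, e1, e2]
    rw [sum_congr rfl hterm, sum_add_distrib,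
      sum_choose_succ_nsmul (fun i j => (⇑u)^[i] ((⇑v)^[j] x)) n]

/-- **`(u + v)^p = u^p + v^p`** for commuting additive endomorphisms `u, v` of an abelian group
all of whose elements are killed by `p` (the middle binomial coefficients vanish).
[cite: Jacobson1962LieAlgebras, V.7] -/
theorem iterate_add_prime_of_commute {M : Type*} [AddCommGroup M] (p : ℕ) [hp : Fact p.Prime]
    (hM : ∀ x : M, p • x = 0) (u v : M →+ M) (huv : ∀ x, u (v x) = v (u x)) (x : M) :
    (fun y => u y + v y)^[p] x = (⇑u)^[p] x + (⇑v)^[p] x := by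
  have hp0 : p ≠ 0 := hp.out.ne_zero
  have hmemp : p ∈ range (p + 1) := mem_range.mpr (Nat.lt_succ_self p)
  have hmem0 : 0 ∈ (range (p + 1)).erase p :=
    mem_erase.mpr ⟨fun h => hp0 h.symm, mem_range.mpr (Nat.succ_pos p)⟩
  rw [iterate_add_eq_sum_choose u v huv, ← add_sum_erase _ _ hmemp, ← add_sum_erase _ _ hmem0,
    Nat.choose_self, Nat.choose_zero_right, one_smul, one_smul, Nat.sub_self, Nat.sub_zero,
    Function.iterate_zero_apply, Function.iterate_zero_apply, sum_eq_zero, add_zero]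
  intro k hk
  rw [mem_erase, mem_erase, mem_range] at hk
  obtain ⟨hk0, hkp, hklt⟩ := hk
  have hk1 : k < p := lt_of_le_of_ne (Nat.lt_succ_iff.mp hklt) hkp
  obtain ⟨c, hc⟩ : p ∣ p.choose k := hp.out.dvd_choose_self hk0 hk1
  rw [hc, mul_comm, mul_smul, hM, smul_zero]

end NestedSeries

end Literature.RingTheory.FormalGroups
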